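import Literature.NumberTheory.EllipticCurves.Disegni2017.ChiLineRamifiedNotExceptionalProofs
import Literature.NumberTheory.GaloisRepresentations.HeckeCharacterInfinityTypeBaseChangeProofs
import Mathlib.NumberTheory.GaussSum
import HarnessLib

/-!
# The base change `θ ∘ N_{K/ℚ}` of a Dirichlet character of prime-power conductor at a SPLIT place:
# explicit local values, and Disegni's factors `Z_w`, `L_w`, `Z°_p` there (proofs only)

Topic `Literature/NumberTheory/EllipticCurves`, cluster `Disegni2017` (namespace = path), with the
`GL₁/ℚ` dictionary lemmas in `Literature.NumberTheory.GaloisRepresentations` next to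
`HeckeCharacter.ofDirichlet`, which they concern. THEOREMS ONLY (no definition, no named fact, no
instance; D-0014, D-0026). Companion of `ChiLineRankinSelberg.lean` (typer `bsd-print-cf2-ty2` g49:
Disegni 2017 Thm. A on the cyclotomic line through a finite-order `χ`, both branches of the
interpolation factor `Z_w`, `valueAtP`, `localValueNat`, `localGaussSum`, `zCirc`) and of
`ChiLineRamifiedNotExceptionalProofs.lean` / `DirichletHeckeCharacterConductorProofs.lean` (seat -w8
g20: the conductor exponent of `ψ_θ ∘ N` at a split place, non-vanishing of the local Gauss sum).
Those files decide the BRANCH and give NON-VANISHING; this file computes the VALUES, which the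
factorisation of Disegni's line function through Mazur–Tate–Teitelbaum functions needs (cell
`bsd-print-cf2`, road (C) `disegni-pair-two` of crux stmt-BirchSwinnertonDyer-20368, seat -w8 g21;
planner PREGRADE §5 «state this factorisation as its own lemma»):

* §1 (`GL₁/ℚ`, Neukirch VII (6.9) / VI (1.10)): for a PRIME-POWER modulus `m = p^n` the Hecke
  character `ψ_θ` of `θ` mod `m` takes the value `1` on the uniformiser idele `⟨p⟩_p`
  (`HeckeCharacter.ofDirichlet_localUnits_primeLocalUnit_of_eq_pow`: the unit part of `⟨p⟩_p · p⁻¹`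
  at `p` is `1`, and `p` is the only prime of `m`); `ψ_{θ₁θ₂} = ψ_{θ₁}ψ_{θ₂}`
  (`HeckeCharacter.ofDirichlet_mul`) and `ψ_θ` does not change under `changeLevel`
  (`HeckeCharacter.ofDirichlet_changeLevel`, by the uniqueness half of
  `HeckeCharacter.exists_of_dirichletCharacter_holds`).
* §2 (transfer to a place `w ∣ p` of DEGREE ONE of a Galois `K/ℚ`, `K_w = ℚ_p`, Cassels–Fröhlich
  II §10 / VII §1.2): `(θ∘N)_w(p) = 1` (`valueAtP_baseChangeDirichlet_eq_one`) and
  `(θ∘N)_w(k) = θ(k)⁻¹` for `p ∤ k` (`localValueNat_baseChangeDirichlet`), hence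
  `localGaussSum p (θ∘N) w n = gaussSum θ⁻¹ ψ⁰` (`localGaussSum_baseChangeDirichlet`) — the Gauss sum
  `τ(χ̃′_w, ψ_{E_w})` of Theorem A for the character `θ⁻¹` induced on `(𝒪_w/p^n)^× = (ℤ/p^n)^×`.
* §3 (Disegni's factors at a split `p`, `p𝒪_K = 𝔭𝔭′`): for `θ` PRIMITIVE mod `p^n`, `n ≥ 1`,
  `Z_w(θ∘N) = a^{−n} · τ(θ⁻¹)`, `L_w = 1`, so `Z°_p(θ∘N) = u · a^{−2n} · τ(θ⁻¹)²`
  (`zCirc_baseChangeDirichlet_of_isPrimitive`); and at the TRIVIAL character (the unramified point of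
  a line through a ramified `χ` of order `2`, e.g. `θ = χ₈` on the `χ₈ ∘ N`-line at `p = 2`):
  `Z_w(𝟙)/L_w(𝟙) = (1 − a⁻¹)²` for `p ∤ N`, so `Z°_p(𝟙_K) = u · (1 − a⁻¹)⁴` (`zCirc_one_of_not_dvd`)
  — the square of the Mazur–Tate–Teitelbaum Euler factor `(1 − α⁻¹)²` of `L_p(E, 0)`, once for
  each of the two factors `L(E, s)L(E^{(d_K)}, s)` of `L(E/K, s)`.

References: D. Disegni, Compos. Math. 153 (2017), Thm. A (arXiv v3 PDF p. 6 L46–59, p. 7 L1–6)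
[Disegni2017]; J. Neukirch, *Algebraic Number Theory*, Ch. VI §1 Prop. (1.10), Ch. VII §6 Prop. (6.9)
[NeukirchANT1999]; J. W. S. Cassels, A. Fröhlich (eds.), *Algebraic Number Theory*, Ch. II §10,
Ch. VII §1.2 [CasselsFrohlichANT1967]; B. Mazur, J. Tate, J. Teitelbaum, Invent. Math. 84 (1986)
§I.14 (14.3) [MazurTateTeitelbaum1986Invent].
-/

noncomputable section

open scoped NumberField
open NumberField IsDedekindDomain IsDedekindDomain.HeightOneSpectrum Rat.HeightOneSpectrum
  Literature.NumberTheory.Automorphic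

/-! ## §1 `GL₁/ℚ`: `ψ_θ` on the uniformiser idele for a prime-power modulus; products; level change -/

namespace Literature.NumberTheory.GaloisRepresentations

section Rat

variable (v : HeightOneSpectrum (𝓞 ℚ)) [Fact (natGenerator v).Prime]

/-- **An idele whose `v`-component IS the prime `p_v` has trivial local reduction at `v`**: its unit
part `x_v · p_v^{−ord_v x_v} = p_v · p_v⁻¹` is `1`, so `localRed v k x = 1` for every `k`.
[cite: NeukirchANT1999, Ch. VI §1 Prop. (1.10)] -/
theorem Rat.localRed_eq_one_of_padicComp_eq_natGenerator (k : ℕ) {x : ideleGroup ℚ}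
    (hx : Rat.padicComp v x = (natGenerator v : ℚ_[natGenerator v])) : Rat.localRed v k x = 1 := by
  have hp : (natGenerator v : ℚ_[natGenerator v]) ≠ 0 := by
    exact_mod_cast (prime_natGenerator v).ne_zero
  have hord : Rat.ord v x = 1 := by
    unfold Rat.ord
    rw [hx]
    exact Padic.valuation_p
  have hunit : (Rat.padicUnitPart v x : ℤ_[natGenerator v]) = 1 := by
    refine PadicInt.ext ?_
    rw [Rat.coe_padicUnitPart, hx, hord, zpow_neg, zpow_one, mul_inv_cancel₀ hp, PadicInt.coe_one]
  refine Units.ext ?_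
  rw [Rat.val_localRed, hunit, map_one, Units.val_one]

/-- The `v`-component of the uniformiser idele `⟨p_v⟩_v`, read in `ℚ_{p_v}`, is `p_v`. [folklore] -/
private theorem Rat.padicComp_localUnits_primeLocalUnit :
    Rat.padicComp v (localUnits v (Rat.primeLocalUnit v)) = (natGenerator v : ℚ_[natGenerator v]) := by
  rw [Rat.padicComp_apply, localUnits_snd_apply_self, Rat.primeLocalUnit, Units.val_mk0, map_natCast]

/-- The `v`-component of the principal idele `(p_v)`, read in `ℚ_{p_v}`, is `p_v`. [folklore] -/
private theorem Rat.padicComp_principalIdele_primeUnit :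
    Rat.padicComp v (principalIdele ℚ (Rat.primeUnit v)) = (natGenerator v : ℚ_[natGenerator v]) := by
  rw [Rat.padicComp_apply, principalIdele_snd, Rat.toPadic_algebraMap, Rat.val_primeUnit,
    Rat.cast_natCast]

/-- **For a prime-power modulus `m = p_v^n`, `redMod m x = 1` whenever `x_v = p_v`** (the only prime
factor of `m` is `p_v`, and there the unit part of `x` is `1`).
[cite: NeukirchANT1999, Ch. VI §1 Prop. (1.10)] -/
theorem Rat.redMod_eq_one_of_padicComp_eq_natGenerator {m n : ℕ} [NeZero m]
    (hm : m = natGenerator v ^ n) {x : ideleGroup ℚ}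
    (hx : Rat.padicComp v x = (natGenerator v : ℚ_[natGenerator v])) : Rat.redMod m x = 1 := by
  subst hm
  refine Rat.redMod_eq_one _ fun q => ?_
  -- every prime factor of `m` is `p_v`, so its place is `v`
  have key : ∀ r : ℕ, r ∈ (natGenerator v ^ n).primeFactors → r = natGenerator v := by
    intro r hr
    rcases Nat.eq_zero_or_pos n with hn | hn
    · exfalso
      rw [hn, pow_zero, Nat.primeFactors_one] at hr
      exact Finset.notMem_empty _ hr
    · rwa [Nat.primeFactors_prime_pow hn.ne' (prime_natGenerator v), Finset.mem_singleton] at hr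
  have hq : (q : ℕ) = natGenerator v := key q q.2
  have hplace : Rat.placeOfFactor (natGenerator v ^ n) q = v :=
    Rat.natGenerator_injective (by rw [Rat.natGenerator_placeOfFactor, hq])
  rw [hplace]
  exact Rat.localRed_eq_one_of_padicComp_eq_natGenerator v _ hx

/-- **The ray class map mod `p^n` kills the uniformiser idele `⟨p⟩_p`.** With `m = p_v^n`:
`rayClassHom m ⟨p_v⟩_v = redMod m (⟨p_v⟩_v · (p_v)⁻¹) = 1 · 1⁻¹ = 1` (both ideles have `v`-component
`p_v`, whose unit part is `1`; Neukirch VI (1.10): `u(x) mod m`).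
[cite: NeukirchANT1999, Ch. VI §1 Prop. (1.10)] -/
theorem Rat.rayClassHom_localUnits_primeLocalUnit_of_eq_pow {m n : ℕ} [NeZero m]
    (hm : m = natGenerator v ^ n) :
    Rat.rayClassHom m (localUnits v (Rat.primeLocalUnit v)) = 1 := by
  rw [Rat.rayClassHom_apply, Rat.unitIdele_apply, Rat.ratPart_localUnits_primeLocalUnit, map_mul,
    map_inv, Rat.redMod_eq_one_of_padicComp_eq_natGenerator v hm (Rat.padicComp_localUnits_primeLocalUnit v),
    Rat.redMod_eq_one_of_padicComp_eq_natGenerator v hm (Rat.padicComp_principalIdele_primeUnit v),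
    inv_one, mul_one]

end Rat

namespace HeckeCharacter

/-- **`ψ_θ(⟨p⟩_p) = 1` for `θ` of prime-power modulus `m = p^n`** (`p = p_v`): the Hecke character of a
Dirichlet character of `p`-power level is `1` on the uniformiser idele at `p` (its unit part mod `m`
is `1`). This is the tree's normalisation `ψ_θ(⟨ϖ_ℓ⟩) = θ(ℓ)` (`ℓ ∤ m`) completed at the one ramified
prime: Disegni's `χ′_w(ϖ_w) = 1` for `χ′ = θ_K` at `w ∣ p` (cluster docstring (c4) of
`CyclotomicLineRankinSelberg.lean`: «`1` at the idele `p`»).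
[cite: NeukirchANT1999, Ch. VII §6 Prop. (6.9) and Ch. VI §1 Prop. (1.10)] -/
theorem ofDirichlet_localUnits_primeLocalUnit_of_eq_pow (v : HeightOneSpectrum (𝓞 ℚ)) {m n : ℕ}
    [NeZero m] (hm : m = natGenerator v ^ n) (θ : DirichletCharacter ℂ m) :
    HeckeCharacter.ofDirichlet θ (localUnits v (Rat.primeLocalUnit v)) = 1 := by
  haveI := Rat.fact_prime_natGenerator v
  rw [HeckeCharacter.ofDirichlet_apply, Rat.rayClassHom_localUnits_primeLocalUnit_of_eq_pow v hm,
    map_one, inv_one]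

/-- **`ψ_{θ₁θ₂} = ψ_{θ₁} · ψ_{θ₂}`** for Dirichlet characters of the same modulus (the dictionary
`θ ↦ ψ_θ` is a homomorphism; immediate from `ψ_θ(x) = θ(u(x) mod m)⁻¹`).
[cite: NeukirchANT1999, Ch. VII §6 Prop. (6.9)] -/
theorem ofDirichlet_mul {m : ℕ} [NeZero m] (θ₁ θ₂ : DirichletCharacter ℂ m) :
    HeckeCharacter.ofDirichlet (θ₁ * θ₂) =
      HeckeCharacter.ofDirichlet θ₁ * HeckeCharacter.ofDirichlet θ₂ := by
  refine HeckeCharacter.ext fun x => ?_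
  rw [HeckeCharacter.mul_apply, HeckeCharacter.ofDirichlet_apply, HeckeCharacter.ofDirichlet_apply,
    HeckeCharacter.ofDirichlet_apply, ← mul_inv]
  congr 1
  refine Units.ext ?_
  rw [Units.val_mul, MulChar.coe_toUnitHom, MulChar.coe_toUnitHom, MulChar.coe_toUnitHom,
    MulChar.coeToFun_mul, Pi.mul_apply]

/-- **`ψ_θ` depends only on the underlying character, not on the level at which it is written**:
`ψ_{changeLevel θ} = ψ_θ` for every `d ∣ n`. Both sides are finite-order Hecke characters of `ℚ`
unramified at the primes `ℓ ∤ n` with `ψ(⟨ϖ_ℓ⟩) = θ(ℓ)` there, and such a character is unique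
(`HeckeCharacter.exists_of_dirichletCharacter_holds`, Neukirch VII (6.9)).
[cite: NeukirchANT1999, Ch. VII §6 Prop. (6.9)] -/
theorem ofDirichlet_changeLevel {d n : ℕ} [NeZero d] [NeZero n] (h : d ∣ n)
    (θ : DirichletCharacter ℂ d) :
    HeckeCharacter.ofDirichlet (DirichletCharacter.changeLevel h θ) = HeckeCharacter.ofDirichlet θ := by
  obtain ⟨ψ₁, -, huniq⟩ :=
    HeckeCharacter.exists_of_dirichletCharacter_holds (DirichletCharacter.changeLevel h θ)
  have h1 : HeckeCharacter.ofDirichlet (DirichletCharacter.changeLevel h θ) = ψ₁ := by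
    refine huniq _ ⟨HeckeCharacter.isFiniteOrder_ofDirichlet _, fun v hv => ?_⟩
    rw [Rat.natCast_mem_asIdeal_iff] at hv
    exact ⟨HeckeCharacter.isUnramifiedAt_ofDirichlet _ hv,
      HeckeCharacter.valueAtUniformizer_ofDirichlet _ hv⟩
  have h2 : HeckeCharacter.ofDirichlet θ = ψ₁ := by
    refine huniq _ ⟨HeckeCharacter.isFiniteOrder_ofDirichlet _, fun v hv => ?_⟩
    rw [Rat.natCast_mem_asIdeal_iff] at hv
    have hvd : ¬ natGenerator v ∣ d := fun hd => hv (hd.trans h)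
    refine ⟨HeckeCharacter.isUnramifiedAt_ofDirichlet _ hvd, ?_⟩
    rw [HeckeCharacter.valueAtUniformizer_ofDirichlet _ hvd]
    have hu : IsUnit ((v.residueCard : ℕ) : ZMod n) := by
      rw [ZMod.isUnit_iff_coprime, Rat.residueCard_eq_natGenerator]
      exact (Nat.Prime.coprime_iff_not_dvd (prime_natGenerator v)).2 hv
    rw [← hu.unit_spec, DirichletCharacter.changeLevel_eq_cast_of_dvd θ h, hu.unit_spec,
      ZMod.cast_natCast h]
  rw [h1, h2]

end HeckeCharacter

end Literature.NumberTheory.GaloisRepresentations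


/-! ## §2 Transfer to a place of degree one of `K`: the local values of `θ ∘ N_{K/ℚ}` -/

namespace Literature.NumberTheory.EllipticCurves.Disegni2017

open Literature.NumberTheory.GaloisRepresentations

variable {p : ℕ} [hp : Fact p.Prime] {K : Type} [Field K] [NumberField K] [IsGalois ℚ K]

omit [IsGalois ℚ K] in
/-- The unit `natUnitAt w k` of `K_w` is the image of the unit `natUnitAt v k` of `ℚ_v` under the
local embedding `ℚ_v → K_w` (`w ∣ v`; both are the natural number `k`). [folklore] -/
private theorem natUnitAt_eq_map_adicCompletionOfLiesOver (v : HeightOneSpectrum (𝓞 ℚ))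
    (w : HeightOneSpectrum (𝓞 K)) [w.asIdeal.LiesOver v.asIdeal] (k : ℕ) (hk : k ≠ 0) :
    natUnitAt w k hk =
      Units.map (adicCompletionOfLiesOver ℚ K v w).toMonoidHom (natUnitAt v k hk) := by
  refine Units.ext ?_
  rw [coe_natUnitAt, Units.coe_map, RingHom.toMonoidHom_eq_coe, MonoidHom.coe_coe, coe_natUnitAt,
    map_natCast]

/-- **`(ψ ∘ N_{K/ℚ})_w(k) = ψ_v(k)` at a place `w ∣ v` of degree one** (`e(w|v) = f(w|v) = 1`): the
local component of the base-changed character at the natural number `k ∈ K_wˣ` is that of `ψ` at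
`k ∈ ℚ_vˣ` (`N_{K_w/ℚ_v} = id` on `K_w = ℚ_v`). [cite: CasselsFrohlichANT1967, Ch. II §10 and Ch. VII §1.2] -/
theorem localComponent_compRelNorm_natUnitAt_of_degree_one (ψ : HeckeCharacter ℚ)
    (v : HeightOneSpectrum (𝓞 ℚ)) (w : HeightOneSpectrum (𝓞 K)) [w.asIdeal.LiesOver v.asIdeal]
    (he : w.asIdeal.ramificationIdx (𝓞 ℚ) = 1) (hf : w.asIdeal.inertiaDeg (𝓞 ℚ) = 1)
    (k : ℕ) (hk : k ≠ 0) :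
    (ψ.compRelNorm K).localComponent w (natUnitAt w k hk) = ψ (localUnits v (natUnitAt v k hk)) := by
  rw [HeckeCharacter.localComponent_apply, natUnitAt_eq_map_adicCompletionOfLiesOver v w k hk,
    HeckeCharacter.compRelNorm_localUnits_map_adicCompletionOfLiesOver,
    HeckeCharacter.ramificationIdxIn_mul_inertiaDegIn_eq_one_of_degree_one (F := ℚ) (E := K) v w he hf,
    pow_one]

/-- At the place `v` of `ℚ` with `p_v = p`, the unit `natUnitAt v p` IS the uniformiser unit
`Rat.primeLocalUnit v` (both are `p ∈ ℚ_vˣ`). [folklore] -/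
private theorem natUnitAt_eq_primeLocalUnit (v : HeightOneSpectrum (𝓞 ℚ)) (hv : natGenerator v = p) :
    natUnitAt v p hp.out.ne_zero = Rat.primeLocalUnit v := by
  refine Units.ext ?_
  rw [coe_natUnitAt, Rat.primeLocalUnit, Units.val_mk0, hv]

omit hp in
/-- The natural number `k`, `p ∤ k`, is a unit of `ℤ_v ⊂ ℚ_v` (`p_v = p`): valuation `1`. [folklore] -/
private theorem valued_natUnitAt_eq_one (v : HeightOneSpectrum (𝓞 ℚ)) (hv : natGenerator v = p) {k : ℕ}
    (hk : ¬ p ∣ k) :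
    Valued.v ((natUnitAt v k (by rintro rfl; exact hk (dvd_zero p)) : (v.adicCompletion ℚ)ˣ) :
      v.adicCompletion ℚ) = 1 := by
  have h : ((natUnitAt v k (by rintro rfl; exact hk (dvd_zero p)) : (v.adicCompletion ℚ)ˣ) :
      v.adicCompletion ℚ) = algebraMap ℚ (v.adicCompletion ℚ) (k : ℚ) := rfl
  rw [h, show Valued.v (algebraMap ℚ (v.adicCompletion ℚ) (k : ℚ)) = v.valuation ℚ (k : ℚ) from
    valued_algebraMap_adicCompletion v (k : ℚ), ← Int.cast_natCast]
  refine Rat.valuation_intCast_eq_one v ?_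
  rw [hv, Int.natCast_dvd_natCast]
  exact hk

/-- **`(θ∘N)_w(p) = 1`**: the base change of a Dirichlet character of `p`-POWER level `p^n` to a
Galois number field `K` has local component `1` at the uniformiser `p` of a place `w ∣ p` of degree
one (`e = f = 1`). (Disegni's `χ′_w(ϖ_w)` for `χ′ = θ_K` on the line: cluster docstring (c4) of
`CyclotomicLineRankinSelberg.lean`.) [cite: Disegni2017, Theorem A, the factor Z_w (arXiv v3 PDF p. 6 L54–59)]
[cite: NeukirchANT1999, Ch. VII §6 Prop. (6.9)] -/
theorem valueAtP_baseChangeDirichlet_eq_one {n : ℕ} [NeZero (p ^ n)] (θ : DirichletCharacter ℂ (p ^ n))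
    (w : HeightOneSpectrum (𝓞 K)) (hw : ((p : ℕ) : 𝓞 K) ∈ w.asIdeal)
    (he : w.asIdeal.ramificationIdx (𝓞 ℚ) = 1) (hf : w.asIdeal.inertiaDeg (𝓞 ℚ) = 1) :
    valueAtP p (baseChangeDirichlet K θ) w = 1 := by
  -- the place `v = (p)` of `ℚ` below `w`
  set v : HeightOneSpectrum (𝓞 ℚ) := w.under (𝓞 ℚ) with hvdef
  haveI : w.asIdeal.LiesOver v.asIdeal := ⟨rfl⟩
  have hvp : natGenerator v = p :=
    LocalField.natGenerator_eq_of_natCast_mem p v (LocalField.natCast_mem_under p w hw)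
  rw [valueAtP_def, baseChangeDirichlet_def,
    localComponent_compRelNorm_natUnitAt_of_degree_one _ v w he hf, natUnitAt_eq_primeLocalUnit v hvp,
    HeckeCharacter.ofDirichlet_localUnits_primeLocalUnit_of_eq_pow v (n := n) (by rw [hvp]) θ,
    Units.val_one]

/-- **`(θ∘N)_w(k) = θ(k)⁻¹` for `p ∤ k`**: the local component at a degree-one place `w ∣ p` of the
base change of `θ` mod `p^n`, at a natural number prime to `p` (a unit of `𝒪_w = ℤ_p`), is
`θ(k mod p^n)⁻¹` — the tree's normalisation of `ψ_θ` puts the inverse on the units (Neukirch VI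
(1.10): the ray class map is reduction of the unit part). [cite: NeukirchANT1999, Ch. VI §1 Prop. (1.10) and Ch. VII §6 Prop. (6.9)]
[cite: Disegni2017, Theorem A, τ(χ̃'_w, ψ_{E_w}) (arXiv v3 PDF p. 7 L2–6)] -/
theorem localValueNat_baseChangeDirichlet {n : ℕ} [NeZero (p ^ n)] (θ : DirichletCharacter ℂ (p ^ n))
    (w : HeightOneSpectrum (𝓞 K)) (hw : ((p : ℕ) : 𝓞 K) ∈ w.asIdeal)
    (he : w.asIdeal.ramificationIdx (𝓞 ℚ) = 1) (hf : w.asIdeal.inertiaDeg (𝓞 ℚ) = 1)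
    {k : ℕ} (hk : ¬ p ∣ k) :
    localValueNat (baseChangeDirichlet K θ) w k = θ⁻¹ (k : ZMod (p ^ n)) := by
  have hk0 : k ≠ 0 := by rintro rfl; exact hk (dvd_zero p)
  set v : HeightOneSpectrum (𝓞 ℚ) := w.under (𝓞 ℚ) with hvdef
  haveI : w.asIdeal.LiesOver v.asIdeal := ⟨rfl⟩
  have hvp : natGenerator v = p :=
    LocalField.natGenerator_eq_of_natCast_mem p v (LocalField.natCast_mem_under p w hw)
  have hcop : k.Coprime (p ^ n) := Nat.Coprime.pow_right _ ((Nat.Prime.coprime_iff_not_dvd hp.out).2 hk).symm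
  rw [localValueNat, dif_neg hk0, baseChangeDirichlet_def,
    localComponent_compRelNorm_natUnitAt_of_degree_one _ v w he hf,
    HeckeCharacter.ofDirichlet_localUnits_eq_of_natCast' θ v hcop ?_ _ (coe_natUnitAt v k hk0)
      (valued_natUnitAt_eq_one v hvp hk)]
  · rw [Units.val_inv_eq_inv_val, MulChar.coe_toUnitHom, ZMod.coe_unitOfCoprime,
      MulChar.inv_apply_eq_inv']
  · -- no prime factor of `p^n` other than `p = p_v`
    intro q hq hne
    exfalso
    apply hne
    rw [hvp]
    rcases Nat.eq_zero_or_pos n with hn | hn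
    · rw [hn, pow_zero, Nat.primeFactors_one] at hq
      exact absurd hq (Finset.notMem_empty _)
    · rwa [Nat.primeFactors_prime_pow hn.ne' hp.out, Finset.mem_singleton] at hq

/-- **The local Gauss sum of `θ ∘ N` at a degree-one place `w ∣ p` is the Gauss sum of `θ⁻¹`**:
`localGaussSum p (θ∘N) w n = Σ_{a mod p^n} θ⁻¹(a) e(a/p^n) = gaussSum θ⁻¹ ψ⁰` (`θ` mod `p^n`, `n ≥ 1`;
the modelling Dirichlet character of Theorem A's `τ(χ̃′_w, ψ_{E_w})` is `θ⁻¹`).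
[cite: Disegni2017, Theorem A, τ(χ̃'_w, ψ_{E_w}) (arXiv v3 PDF p. 7 L2–6)] -/
theorem localGaussSum_baseChangeDirichlet {n : ℕ} (hn : 0 < n) [NeZero (p ^ n)]
    (θ : DirichletCharacter ℂ (p ^ n)) (w : HeightOneSpectrum (𝓞 K)) (hw : ((p : ℕ) : 𝓞 K) ∈ w.asIdeal)
    (he : w.asIdeal.ramificationIdx (𝓞 ℚ) = 1) (hf : w.asIdeal.inertiaDeg (𝓞 ℚ) = 1) :
    localGaussSum p (baseChangeDirichlet K θ) w n = gaussSum θ⁻¹ (ZMod.stdAddChar (N := p ^ n)) :=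
  localGaussSum_eq_gaussSum hn fun _ hk => localValueNat_baseChangeDirichlet θ w hw he hf hk

/-! ## §3 Disegni's factors `Z_w`, `L_w`, `Z°_p` on the line `θ ∘ N` at a split `p` -/

/-- **The base change of a PRIMITIVE `θ` mod `p^n`, `n ≥ 1`, is RAMIFIED at every `𝔮 ∣ p` for `p`
split in the quadratic `K`, with conductor exponent `n`** (Neukirch VII (6.9), seat -w8's
`hasConductorExponentAt_compRelNorm_ofDirichlet_of_split`, read with `v_p(p^n) = n`).
[cite: NeukirchANT1999, Ch. VII §6 Prop. (6.9)] -/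
theorem not_isUnramifiedAt_and_conductorExponentAt_baseChangeDirichlet (h2 : Module.finrank ℚ K = 2)
    (hsplit : ((Ideal.span {(p : ℤ)}).primesOver (𝓞 K)).ncard = 2) {n : ℕ} (hn : 0 < n)
    [NeZero (p ^ n)] {θ : DirichletCharacter ℂ (p ^ n)} (hθ : θ.IsPrimitive)
    (𝔮 : HeightOneSpectrum (𝓞 K)) (h𝔮 : ((p : ℕ) : 𝓞 K) ∈ 𝔮.asIdeal) :
    ¬ (baseChangeDirichlet K θ).IsUnramifiedAt 𝔮 ∧ (baseChangeDirichlet K θ).conductorExponentAt 𝔮 = n := by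
  have hfac : (p ^ n).factorization p = n := by
    rw [Nat.factorization_pow, Finsupp.smul_apply, hp.out.factorization_self, smul_eq_mul, mul_one]
  have h := hasConductorExponentAt_compRelNorm_ofDirichlet_of_split K p h2 hsplit hθ 𝔮 h𝔮
  rw [hfac] at h
  rw [baseChangeDirichlet_def]
  exact ⟨h.pos_iff_not_isUnramifiedAt.mp hn, h.conductorExponentAt_eq⟩

/-- **`Z_w(θ∘N) = a^{−n} · τ(θ⁻¹)`** at each `𝔮 ∣ p` (`p` split in the quadratic `K`, `θ` primitive mod
`p^n`, `n ≥ 1`, `a` the unit-root datum read in `ℂ`): the RAMIFIED branch of Disegni's interpolation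
factor with `χ′_w(ϖ_w) = 1`, conductor `p^n` and `τ = gaussSum θ⁻¹ ψ⁰`.
[cite: Disegni2017, Theorem A, Z_w and τ (arXiv v3 PDF p. 6 L58, p. 7 L1–6)] -/
theorem interpolationFactorZw_baseChangeDirichlet_of_isPrimitive (h2 : Module.finrank ℚ K = 2)
    (hsplit : ((Ideal.span {(p : ℤ)}).primesOver (𝓞 K)).ncard = 2) {n : ℕ} (hn : 0 < n)
    [NeZero (p ^ n)] {θ : DirichletCharacter ℂ (p ^ n)} (hθ : θ.IsPrimitive) (a : ℂ)
    (𝔮 : HeightOneSpectrum (𝓞 K)) (h𝔮 : ((p : ℕ) : 𝓞 K) ∈ 𝔮.asIdeal) :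
    interpolationFactorZw (p := p) a (baseChangeDirichlet K θ) 𝔮 =
      a⁻¹ ^ n * gaussSum θ⁻¹ (ZMod.stdAddChar (N := p ^ n)) := by
  obtain ⟨hram, hcond⟩ :=
    not_isUnramifiedAt_and_conductorExponentAt_baseChangeDirichlet h2 hsplit hn hθ 𝔮 h𝔮
  obtain ⟨he, hf⟩ :=
    ramificationIdx_eq_one_and_inertiaDeg_eq_one_of_ncard_primesOver_eq_two K p h2 hsplit 𝔮 h𝔮
  rw [interpolationFactorZw_of_not_isUnramifiedAt hram, hcond,
    valueAtP_baseChangeDirichlet_eq_one θ 𝔮 h𝔮 he hf, one_mul,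
    localGaussSum_baseChangeDirichlet hn θ 𝔮 h𝔮 he hf]

/-- **`L(1/2, σ_{E,w} ⊗ (θ∘N)_w) = 1`** at each `𝔮 ∣ p` for `θ` primitive mod `p^n`, `n ≥ 1` (ramified
twist). [cite: Disegni2017, Theorem A, Z°_v (arXiv v3 PDF p. 6 L48–50)] -/
theorem localEulerFactor_baseChangeDirichlet_of_isPrimitive (h2 : Module.finrank ℚ K = 2)
    (hsplit : ((Ideal.span {(p : ℤ)}).primesOver (𝓞 K)).ncard = 2) {n : ℕ} (hn : 0 < n)
    [NeZero (p ^ n)] {θ : DirichletCharacter ℂ (p ^ n)} (hθ : θ.IsPrimitive) (a : ℂ) (N : ℕ)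
    (𝔮 : HeightOneSpectrum (𝓞 K)) (h𝔮 : ((p : ℕ) : 𝓞 K) ∈ 𝔮.asIdeal) :
    localEulerFactor (p := p) a N (baseChangeDirichlet K θ) 𝔮 = 1 :=
  localEulerFactor_of_not_isUnramifiedAt
    (not_isUnramifiedAt_and_conductorExponentAt_baseChangeDirichlet h2 hsplit hn hθ 𝔮 h𝔮).1

/-- ★ **`Z°_p(θ∘N) = u · a^{−2n} · τ(θ⁻¹)²`** for `θ` PRIMITIVE mod `p^n`, `n ≥ 1`, at a prime `p` split
in the quadratic field `K` (`𝔭, 𝔭′ ∋ p`; `u = ζ_{ℚ_p}(2)L(1,𝟙)² = splitLocalConstant p`): both local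
factors are in the Gauss-sum branch and both local Euler factors are `1`. At `p = 2`, `K ∋ √d`
with `d ≡ 1 (8)`, `θ = χ₈θ′` this is the interpolation constant of Disegni's function on the line
through `χ₈ ∘ N` — to be compared with `α^{−n}τ` on EACH of the two Mazur–Tate–Teitelbaum factors.
[cite: Disegni2017, Theorem A, Z°_v, Z_w, τ (arXiv v3 PDF p. 6 L46–59, p. 7 L1–6)] -/
theorem zCirc_baseChangeDirichlet_of_isPrimitive (h2 : Module.finrank ℚ K = 2)
    (hsplit : ((Ideal.span {(p : ℤ)}).primesOver (𝓞 K)).ncard = 2) {n : ℕ} (hn : 0 < n)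
    [NeZero (p ^ n)] {θ : DirichletCharacter ℂ (p ^ n)} (hθ : θ.IsPrimitive) (a : ℂ) (N : ℕ)
    (𝔭 𝔭' : HeightOneSpectrum (𝓞 K)) (h𝔭 : ((p : ℕ) : 𝓞 K) ∈ 𝔭.asIdeal)
    (h𝔭' : ((p : ℕ) : 𝓞 K) ∈ 𝔭'.asIdeal) :
    zCirc (p := p) a N (baseChangeDirichlet K θ) 𝔭 𝔭' =
      (splitLocalConstant p : ℂ) * (a⁻¹ ^ n * gaussSum θ⁻¹ (ZMod.stdAddChar (N := p ^ n))) ^ 2 := by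
  rw [zCirc, interpolationFactorZw_baseChangeDirichlet_of_isPrimitive h2 hsplit hn hθ a 𝔭 h𝔭,
    interpolationFactorZw_baseChangeDirichlet_of_isPrimitive h2 hsplit hn hθ a 𝔭' h𝔭',
    localEulerFactor_baseChangeDirichlet_of_isPrimitive h2 hsplit hn hθ a N 𝔭 h𝔭,
    localEulerFactor_baseChangeDirichlet_of_isPrimitive h2 hsplit hn hθ a N 𝔭' h𝔭', div_one, sq,
    mul_assoc]

omit [IsGalois ℚ K] in
/-- **`Z_w(𝟙) = (1 − a⁻¹)/(1 − a p⁻¹)`**: the UNRAMIFIED branch of Disegni's factor at the trivial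
character (`χ′_w(ϖ_w) = 1`). [cite: Disegni2017, Theorem A, Z_w (arXiv v3 PDF p. 6 L57)] -/
theorem interpolationFactorZw_one (a : ℂ) (w : HeightOneSpectrum (𝓞 K)) :
    interpolationFactorZw (p := p) a (1 : HeckeCharacter K) w = (1 - a⁻¹) / (1 - a * ((p : ℂ))⁻¹) := by
  rw [interpolationFactorZw_of_isUnramifiedAt
    (χ := (1 : HeckeCharacter K)) (fun _ => by rw [HeckeCharacter.localComponent_apply, HeckeCharacter.one_apply]), valueAtP_one, inv_one, mul_one,
    mul_one]

omit [IsGalois ℚ K] in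
/-- **`L(1/2, σ_{E,w}) = [(1 − a p⁻¹)(1 − a⁻¹)]⁻¹`** at the trivial character for `p ∤ N` (good
reduction: `e_p = p`, second Satake parameter `p/a`). [cite: Disegni2017, Theorem A, Z°_v (arXiv v3 PDF p. 6 L48–50)] -/
theorem localEulerFactor_one_of_not_dvd (a : ℂ) {N : ℕ} (hpN : ¬ p ∣ N) (w : HeightOneSpectrum (𝓞 K)) :
    localEulerFactor (p := p) a N (1 : HeckeCharacter K) w =
      ((1 - a * ((p : ℂ))⁻¹) * (1 - a⁻¹))⁻¹ := by
  have hp0 : (p : ℂ) ≠ 0 := Nat.cast_ne_zero.mpr hp.out.ne_zero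
  rw [localEulerFactor, if_pos (show (1 : HeckeCharacter K).IsUnramifiedAt w from
    (fun _ => by rw [HeckeCharacter.localComponent_apply, HeckeCharacter.one_apply])), if_neg hpN, valueAtP_one, mul_one, mul_one,
    mul_right_comm (p : ℂ), mul_inv_cancel₀ hp0, one_mul]

omit [IsGalois ℚ K] in
/-- ★ **`Z°_p(𝟙_K) = u · (1 − a⁻¹)⁴`** at a split `p ∤ N` (`𝔭, 𝔭′` the two places; `a ≠ p`, automatic
for a `p`-adic unit root read in `ℂ`): at each place `Z_w/L_w = (1 − a⁻¹)/(1 − a/p) · (1 − a/p)(1 − a⁻¹)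
= (1 − a⁻¹)²` — the Mazur–Tate–Teitelbaum Euler factor `(1 − α⁻¹)²` of `L_p(E, T)` at `T = 0`
(MTT §I.14 (14.3)), once per factor of `L(E/K, s) = L(E, s)·L(E^{(d_K)}, s)`. On the line through
`χ₈ ∘ N` at `p = 2` this is the point `θ = χ₈` (`χ₈² = 𝟙`), `T = −2`.
[cite: Disegni2017, Theorem A, Z°_v, Z_w (arXiv v3 PDF p. 6 L46–57)]
[cite: MazurTateTeitelbaum1986Invent, §I.14 (14.3)] -/
theorem zCirc_one_of_not_dvd (a : ℂ) (ha : a ≠ (p : ℂ)) {N : ℕ} (hpN : ¬ p ∣ N)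
    (𝔭 𝔭' : HeightOneSpectrum (𝓞 K)) :
    zCirc (p := p) a N (1 : HeckeCharacter K) 𝔭 𝔭' = (splitLocalConstant p : ℂ) * (1 - a⁻¹) ^ 4 := by
  have hp0 : (p : ℂ) ≠ 0 := Nat.cast_ne_zero.mpr hp.out.ne_zero
  have hden : 1 - a * ((p : ℂ))⁻¹ ≠ 0 := by
    intro h0
    apply ha
    field_simp at h0
    linear_combination -h0
  have hloc : ∀ w : HeightOneSpectrum (𝓞 K),
      interpolationFactorZw (p := p) a (1 : HeckeCharacter K) w /
          localEulerFactor (p := p) a N (1 : HeckeCharacter K) w = (1 - a⁻¹) ^ 2 := by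
    intro w
    rw [interpolationFactorZw_one, localEulerFactor_one_of_not_dvd a hpN, div_eq_mul_inv, inv_inv]
    field_simp
  rw [zCirc, hloc 𝔭, hloc 𝔭', mul_assoc, ← pow_add]

end Literature.NumberTheory.EllipticCurves.Disegni2017

end
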